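import Summits.AtomisticToContinuum.BoseEinsteinCondensation.Theses.BECConjugateDomination
import Literature.Barriers.AtomisticToContinuum.KineticGapLengthScalesThermodynamicWindow
import HarnessLib

/-!
# The finite-energy hypothesis of `PuffFloor` is decoration (negative-side lemma for crux `PuffFloor`, stmt-AtomisticToContinuum-11785)

Cycle-2 file of the refuter's negative-side chain for crux `PuffFloor` of route
`BECConjugateDomination` (cdisprove seat gen 2, 2026-08-16). LOAD-BEARING ANALYSIS, continued:

* `PuffFloorWithoutFiniteEnergy` — the crux with the hypothesis `periodicEnergy v Ψ ≠ ⊤` DROPPED,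
  everything else verbatim;
* `puffFloorWithoutFiniteEnergy_of_puffFloor : PuffFloor → PuffFloorWithoutFiniteEnergy` — the
  hypothesis adds nothing: by `exists_eventually_periodicGroundStateEnergy_lt_top` (Ruelle §3.5.11,
  every repulsive finite-range `v`, hard cores included) the periodic ground-state energy along
  `L = sideLength ρ N` is finite for all large `N` at small `ρ`, so an exact minimiser has finite
  energy automatically after shrinking `ρ₀`. (The converse implication is the trivial
  "dropping a hypothesis strengthens" and is not stated, since its conclusion is the Theses decl.)

No Theses statement is asserted positively. All `[folklore]`.
-/

noncomputable section

namespace Summit.AtomisticToContinuum.BoseEinsteinCondensation.Theorems.PuffFloor.Negative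

open Literature.MathematicalPhysics.QuantumManyBody.BoseGas MeasureTheory Complex Finset
open scoped ComplexConjugate BigOperators ENNReal NNReal

/-! ### Decoration: the finite-energy hypothesis is implied by minimality -/

/-- `PuffFloor` with the hypothesis `periodicEnergy v Ψ ≠ ⊤` DROPPED (everything else verbatim). -/
def PuffFloorWithoutFiniteEnergy : Prop :=
  ∀ v : ℝ → ENNReal, IsRepulsiveFiniteRange v → (∀ r, v r ≠ ⊤) →
    ContDiff ℝ 2 (fun x : Space => (v ‖x‖).toReal) →
    (∃ Cₑ : ℝ, ∀ x : Space, ‖iteratedFDeriv ℝ 2 (fun x : Space => (v ‖x‖).toReal) x‖ ≤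
      Cₑ * Real.sqrt ((v ‖x‖).toReal)) →
    ∃ C : ℝ, 0 ≤ C ∧ ∃ ρ₀ : ℝ, 0 < ρ₀ ∧ ∀ ρ : ℝ, 0 < ρ → ρ < ρ₀ →
      ∀ᶠ n : ℕ in Filter.atTop, ∀ Ψ : PeriodicTrialState (n + 1) (sideLength ρ (n + 1)),
        (let L : ℝ := sideLength ρ (n + 1)
         let S : (Fin 3 → ℤ) → ℝ := fun m => ((n : ℝ) + 1)⁻¹ *
           ∫ X in cellN (n + 1) L, ‖∑ j : Fin (n + 1), cellWave L m (X j)‖ ^ 2 * ‖Ψ.ψ X‖ ^ 2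
         let kn : (Fin 3 → ℤ) → ℝ := fun m => ‖((2 * Real.pi / L) • latticeVec 1 m)‖
         periodicEnergy v Ψ = periodicGroundStateEnergy v (n + 1) L →
           (∀ X, Ψ.ψ X = (‖Ψ.ψ X‖ : ℂ)) → (∀ X, Ψ.ψ X ≠ 0) →
           ∀ m : Fin 3 → ℤ, m ≠ 0 → kn m / Real.sqrt (kn m ^ 2 + C * ρ) ≤ S m)

/-- **`periodicEnergy v Ψ ≠ ⊤` is decoration**: for every repulsive finite-range `v` (hard
cores included) the periodic ground-state energy along `L = sideLength ρ N` is finite for all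
large `N` once `ρ` is small (`exists_eventually_periodicGroundStateEnergy_lt_top`, Ruelle §3.5.11),
so an exact minimiser has finite energy automatically after shrinking `ρ₀`; removing the
hypothesis gives an EQUIVALENT statement (the converse direction — dropping a hypothesis
strengthens — is trivial and omitted here because its conclusion would assert the Theses decl).
A planner may drop it; a prover gets it for free. [folklore] -/
theorem puffFloorWithoutFiniteEnergy_of_puffFloor
    (h : Summit.AtomisticToContinuum.BoseEinsteinCondensation.Theses.BECConjugateDomination.PuffFloor) :
    PuffFloorWithoutFiniteEnergy := by
    intro v h1 h2 h3 h4
    obtain ⟨C, hC, ρ₀, hρ₀, h⟩ := h v h1 h2 h3 h4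
    obtain ⟨ρ₁, hρ₁, hfin⟩ :=
      Literature.Barriers.AtomisticToContinuum.BoseGas.exists_eventually_periodicGroundStateEnergy_lt_top h1
    refine ⟨C, hC, min ρ₀ ρ₁, lt_min hρ₀ hρ₁, fun ρ hρ hρ' => ?_⟩
    have hA := h ρ hρ (lt_of_lt_of_le hρ' (min_le_left _ _))
    have hB := (Filter.tendsto_add_atTop_nat 1).eventually
      (hfin ρ hρ (lt_of_lt_of_le hρ' (min_le_right _ _)))
    filter_upwards [hA, hB] with n hn hn' Ψ
    intro L S kn hE hre hne m hm
    have hfinΨ : periodicEnergy v Ψ ≠ ⊤ := by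
      rw [hE]; exact hn'.ne
    exact hn Ψ hE hfinΨ hre hne m hm

end Summit.AtomisticToContinuum.BoseEinsteinCondensation.Theorems.PuffFloor.Negative

end
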